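import Summits.BirchSwinnertonDyer.Rank1Residual.X11b.TameCupLocalLemmas
import Summits.BirchSwinnertonDyer.Rank1Residual.X11b.TameCupDeterminantForm
import Summits.BirchSwinnertonDyer.Rank1Residual.GaloisImage.UnramifiedCupProductVanishing
import Summits.BirchSwinnertonDyer.Rank1Residual.GaloisImage.KolyvaginPrimeLocalShape
import Summits.BirchSwinnertonDyer.Rank1Residual.X11b.MaxUnramifiedRestriction
import HarnessLib

/-!
# The tame cup-product shape: Gross 1991 (7.6) in qualitative form
# (cell `b2b-bsdres`, team x11b3 = N8/O2, seat p3 GEN 10, (P3-B) FILE 1b; lead R10-65)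

HONEST FRAMING (cell `b2b-bsdres`, run/shared/lean/b2b/bsd-rank1-residual/, verbatim in every
file): the goal of the cell is to DELETE the COMBINATION-SHAPED residual classes of the
Birch–Swinnerton-Dyer formula for ALL analytic-rank `≤ 1` elliptic curves over `ℚ` — "full BSD
formula for every rank `≤ 1` curve in class `C`" assembled STRICTLY from published theorems — so
that the rank-`≤ 1` remainder becomes exactly the CONSTRUCTION-SHAPED classes, which are TYPED
(missing-input `Prop`s), NOT attempted. This is not "finishing BSD". Team N8/O2 = `x11b3`, seat
`b2b-bsdres-x11b3-p3` GEN 10, lead deal R10-65 (P3-B): plumbing / debt reduction on the PUBLISHED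
Kolyvagin finiteness theorem (Gross 1991, Thm. 1.3 (2)) — the LOCAL half of the road to leaf (B) =
Kolyvagin reciprocity (R)_M (`hR` of `KolyvaginDescent.Kolyvagin1990_sha_primary_finite_of_pointsM_of_reciprocityM`)
from Poitou–Tate. ONE THEOREM (no definition, no named fact, no `sorry`); nothing `p = 3`-specific;
`hpoints` / (γ) / `hexc` / `hK1` untouched; nothing discharged on the residual map yet (FILE 2,
`X11b/KolyvaginReciprocityOfPoitouTate.lean`); nothing booked; no mark / label / count / tier moved.

`weilPairing_apply_eq_one_of_cupProduct_eq_zero` is Gross 1991 (7.6) ("`ζ^{⟨c₁,c₂⟩} = {e₁, e₂}`",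
PDF p. 225, proof in Washington's appendix [W]) in the qualitative form used by Prop. 8.1 (2) /
McCallum Lemma 5.3: at a local field on whose Galois group `E[n]` is trivial, for `φ` unramified,
`[φ] ∪ₑ [ψ] = 0 ⟹ e(φ(g), ψ(t)) = 1` (`t` inertial). Proved WITHOUT a cocycle formula from: local
Tate duality (tree, PROVED: `eq_zero_of_forall_weilCupProduct_eq_zero(_right)`), `H¹_ur ∪ H¹_ur = 0`
(team n1011's `cupClass_eq_zero_of_vanishing_of_subsingleton`), `#H¹_ur = #E[n]`
(`natCard_unramifiedSubgroup_eq_natCard_invariants`), the tame generator and Frobenius generation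
(FILE 1b-i `TameCupLocalLemmas`), counting (`forall_mem_apply_eq_zero_iff_of_isotropic_of_card_le`),
`SL₂`-naturality of the cup product (`ContPairing.cupProduct_map`) and the determinant-form algebra
of FILE 1a (`TameCup.eq_zero_iff_of_isometry_invariant`). The local objects (`rep`, evaluations,
`B = inv ∘ ∪ₑ`, the `SL₂` action, `Θ`) are `let`/`have`s of the one proof; equalities across the
`galoisCohomology` / `continuousCohomology` carriers are proved in term mode. Namespace
`Summit.BirchSwinnertonDyer.Rank1Residual.X11b.TameCup`; the (always available) instance
`CompactSpace Γ_F` is a binder (consumers: `haveI := absoluteGaloisGroup_compactSpace F`) instead of a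
local instance attribute; axioms `propext`, `Classical.choice`, `Quot.sound`.
References (locators only; no cited FACT): [cite: GrossLMS1991, §7 (7.2)–(7.6),
Prop. 7.5, Prop. 8.1 (2), Prop. 8.2 (PDF pp. 224–226)] [cite: McCallumLMS1991, §2 Prop. 2.2, §5
Lemma 5.3] [cite: MilneADT2006, Ch. I Cor. 2.3, Thm. 2.6] [cite: SerreLocalFields1979, Ch. IV §2].
-/

noncomputable section

open scoped Classical

universe u

namespace Summit.BirchSwinnertonDyer.Rank1Residual.X11b.TameCup

open CategoryTheory WeierstrassCurve Field Function ValuativeRel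
open Literature.NumberTheory.EllipticCurves
open Literature.NumberTheory.GaloisRepresentations
open Literature.NumberTheory.GaloisRepresentations.IsNonarchimedeanLocalField
open Literature.NumberTheory.GaloisRepresentations.DiscreteGaloisModule (mu MuCarrier)
open _root_.TopRep _root_.ContinuousCohomology
open scoped ContRepresentation


section Main

variable {K : Type u} [Field K] [CharZero K] (W : WeierstrassCurve K) (n : ℕ) [NeZero n] [W.IsElliptic]
variable (e : geomTorsion W n → geomTorsion W n → AlgebraicClosure K) (hμ : ∀ S T, e S T ^ n = 1)
  (hadd₁ : ∀ S₁ S₂ T, e (S₁ + S₂) T = e S₁ T * e S₂ T) (hadd₂ : ∀ S T₁ T₂, e S (T₁ + T₂) = e S T₁ * e S T₂)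
variable (F : Type u) [Field F] [Algebra K F] [CharZero F] [ValuativeRel F] [TopologicalSpace F]
  [IsNonarchimedeanLocalField F] [CompactSpace (absoluteGaloisGroup F)]


/-- **The tame cup-product shape (Gross 1991, (7.6), qualitative form).** For `E = W` elliptic
over `K` (char. `0`), a Weil pairing `e` on `E[n]`, a non-archimedean local field `F ⊇ K` with
residue characteristic prime to `n` acting TRIVIALLY on `E[n]`, an injective additive
`inv : H²(F, μₙ) → ℤ/n`, a frame `ε : E[n] ≃+ ℤ/n × ℤ/n`, and continuous crossed homomorphisms
`φ, ψ : Γ_F → E[n]` with `φ|_{I_F} = 0` and `[φ] ∪ₑ [ψ] = 0` in `H²(F, μₙ)`: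
`e(φ(g), ψ(t)) = 1` for every `g ∈ Γ_F`, `t ∈ I_F`. Proof in the module docstring (local Tate
duality, `H¹_ur = H¹_ur^⊥` by inflation and counting, tame generator, `SL₂`-naturality of the cup
product, determinant-form algebra); no cocycle formula. [cite: GrossLMS1991, §7 (7.6), Prop. 7.5,
Prop. 8.1 (2)] [cite: MilneADT2006, Ch. I Cor. 2.3, Thm. 2.6] [cite: SerreLocalFields1979, Ch. IV §2] -/
theorem weilPairing_apply_eq_one_of_cupProduct_eq_zero
    (halt : ∀ T, e T T = 1) (hnondeg : ∀ T, (∀ S, e S T = 1) → T = 0)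
    (hgal : ∀ (σ : absoluteGaloisGroup K) (S T : geomTorsion W n), σ • e S T = e (σ • S) (σ • T))
    (ε : geomTorsion W n ≃+ ZMod n × ZMod n)
    (hn : ¬ ringChar 𝓀[F] ∣ n)
    (htriv : ∀ (g : absoluteGaloisGroup F) (P : geomTorsion W n), absGaloisRestrict K F g • P = P)
    (inv : galoisCohomology (GaloisRep.restrictField F (mu K n)) 2 →+ ZMod n)
    (hinv : Function.Injective inv)
    (φ ψ : contOneCocycles (GaloisRep.restrictField F (W.torsionGaloisModule n)).toTopRep)
    (hφ : ∀ t ∈ absInertia F, φ.1 t = 0)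
    (hcup : ((weilContPairing W n e hμ hadd₁ hadd₂ hgal).restrict (absGaloisRestrict K F)).cupProduct
      (oneCocycleClass _ φ) (oneCocycleClass _ ψ) = 0)
    (g t : absoluteGaloisGroup F) (ht : t ∈ absInertia F) :
    e (φ.1 g) (ψ.1 t) = 1 := by
  classical
  haveI : Finite (geomTorsion W (n : ℤ)) := finite_geomTorsion_of_neZero W n
  let ρF : DiscreteGaloisModule F (geomTorsion W n) :=
    GaloisRep.restrictField F (W.torsionGaloisModule n)
  have htrivX : ∀ (g : absoluteGaloisGroup F) (x : ρF.toTopRep), ρF.toTopRep.ρ g x = x := htriv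
  have hI : ∀ τ ∈ absInertia F, ∀ w : geomTorsion W n, ρF τ w = w := fun τ _ w => htriv τ w
  set P := (weilContPairing W n e hμ hadd₁ hadd₂ hgal).restrict (absGaloisRestrict K F) with hP
  haveI hfinV : Finite (galoisCohomology ρF 1) := finite_galoisCohomology_one_of_isNonarchimedeanLocalField ρF
  set Wp := weilPairingHom W n e hμ hadd₁ hadd₂ with hWp
  have hWalt : ∀ x, Wp x x = 0 := weilPairingHom_self W n e hμ hadd₁ hadd₂ halt
  have hWnd : ∀ x, (∀ y, Wp x y = 0) → x = 0 := weilPairingHom_left_nondeg W n e hμ hadd₁ hadd₂ halt hnondeg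
  let rep : galoisCohomology ρF 1 → contOneCocycles ρF.toTopRep :=
    surjInv (oneCocycleClass_surjective ρF.toTopRep)
  have hrep : ∀ a : galoisCohomology ρF 1, oneCocycleClass ρF.toTopRep (rep a) = a :=
    fun a => surjInv_eq (oneCocycleClass_surjective ρF.toTopRep) a
  have hrep_class : ∀ (f : contOneCocycles ρF.toTopRep) (g : absoluteGaloisGroup F),
      (rep (oneCocycleClass _ f)).1 g = f.1 g :=
    fun f g => apply_eq_of_oneCocycleClass_eq htrivX (hrep _) g
  have hrep_zero : ∀ g : absoluteGaloisGroup F, (rep 0).1 g = 0 := fun g => by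
    have h : oneCocycleClass ρF.toTopRep (rep 0) = oneCocycleClass ρF.toTopRep 0 := by
      rw [hrep, oneCocycleClass_zero]; rfl
    rw [apply_eq_of_oneCocycleClass_eq htrivX h g]; rfl
  have hrep_add : ∀ (a b : galoisCohomology ρF 1) (g : absoluteGaloisGroup F),
      (rep (a + b)).1 g = (rep a).1 g + (rep b).1 g := fun a b g => by
    have h : oneCocycleClass _ (rep (a + b)) = oneCocycleClass _ (rep a + rep b) := by
      rw [hrep, oneCocycleClass_add, hrep, hrep]; rfl
    rw [apply_eq_of_oneCocycleClass_eq htrivX h]; rfl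
  let ev : absoluteGaloisGroup F → galoisCohomology ρF 1 →+ geomTorsion W n := fun g =>
    { toFun := fun a => (rep a).1 g
      map_zero' := hrep_zero g
      map_add' := fun a b => hrep_add a b g }
  have hev : ∀ (g : absoluteGaloisGroup F) (a : galoisCohomology ρF 1), ev g a = (rep a).1 g :=
    fun _ _ => rfl
  have hU_iff : ∀ a : galoisCohomology ρF 1,
      a ∈ DiscreteGaloisModule.unramifiedSubgroup ρF 1 ↔ ∀ t ∈ absInertia F, (rep a).1 t = 0 := fun a => by
    have h := X11b.LocBridge.mem_unramifiedSubgroup_one_iff_forall_eq_zero ρF hI (rep a)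
    rwa [hrep a] at h
  have hcardM : (Nat.card (geomTorsion W (n : ℤ))).Coprime (ringChar 𝓀[F]) := by
    rw [WeierstrassCurve.natCard_geomTorsion W (n : ℤ) (by exact_mod_cast NeZero.ne n), Int.natAbs_natCast]
    exact Nat.Coprime.pow_left 2
      ((Nat.Prime.coprime_iff_not_dvd (ringChar_residueField_prime (F := F))).mpr hn).symm
  haveI : Fintype (galoisCohomology ρF 1) := Fintype.ofFinite _
  obtain ⟨s₁, hs₁I, hs₁⟩ := exists_tame_generator F ρF htriv hcardM
    ((Finset.univ : Finset (galoisCohomology ρF 1)).image rep)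
  have htame : ∀ (a : galoisCohomology ρF 1) (t : absoluteGaloisGroup F), t ∈ absInertia F →
      ∃ k : ℕ, (rep a).1 t = k • (rep a).1 s₁ :=
    fun a t ht => hs₁ (rep a) (Finset.mem_image_of_mem rep (Finset.mem_univ a)) t ht
  obtain ⟨frob, hfrob⟩ := exists_isAbsArithFrob_holds F
  have hker : ∀ a : galoisCohomology ρF 1,
      ev s₁ a = 0 ↔ a ∈ DiscreteGaloisModule.unramifiedSubgroup ρF 1 := fun a => by
    rw [hU_iff, hev]
    constructor
    · intro h t ht
      obtain ⟨k, hk⟩ := htame a t ht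
      rw [hk, h, smul_zero]
    · intro h
      exact h s₁ hs₁I
  have hevF_inj : ∀ a ∈ DiscreteGaloisModule.unramifiedSubgroup ρF 1, ev frob a = 0 → a = 0 := by
    intro a ha h0
    have hvan : ∀ g, (rep a).1 g = 0 := fun g => by
      obtain ⟨k, hk⟩ :=
        exists_apply_eq_zsmul_apply_frob F ρF htriv (rep a) ((hU_iff a).mp ha) hfrob g
      rw [hk, ← hev, h0, smul_zero]
    have hzero : rep a = 0 := Subtype.ext (ContinuousMap.ext hvan)
    rw [← hrep a, hzero, oneCocycleClass_zero]
    rfl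
  have hcardU : Nat.card (DiscreteGaloisModule.unramifiedSubgroup ρF 1) = Nat.card (geomTorsion W (n : ℤ)) := by
    rw [GaloisImage.natCard_unramifiedSubgroup_eq_natCard_invariants ρF hI]
    exact Nat.card_congr
      { toFun := fun v => v.1
        invFun := fun m => ⟨m, fun g => htriv g m⟩
        left_inv := fun _ => rfl
        right_inv := fun _ => rfl }
  let evU : DiscreteGaloisModule.unramifiedSubgroup ρF 1 → geomTorsion W (n : ℤ) := fun a => ev frob a.1
  have hevU_inj : Function.Injective evU := by
    intro a b hab
    apply Subtype.ext
    have h : ev frob (a.1 - b.1) = 0 := by rw [map_sub, sub_eq_zero]; exact hab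
    exact sub_eq_zero.mp (hevF_inj _ (sub_mem a.2 b.2) h)
  have hevU_bij : Function.Bijective evU :=
    hevU_inj.bijective_of_nat_card_le hcardU.ge
  let B : galoisCohomology ρF 1 →+ galoisCohomology ρF 1 →+ ZMod n :=
    { toFun := fun a => inv.comp (P.cupProduct a).toAddMonoidHom
      map_zero' := by
        ext b
        change inv (P.cupProduct (0 : galoisCohomology ρF 1) b) = 0
        have key : P.cupProduct (0 : galoisCohomology ρF 1) = 0 := map_zero P.cupProduct
        rw [key, LinearMap.zero_apply]
        exact map_zero inv
      map_add' := fun a a' => by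
        ext b
        change inv (P.cupProduct (a + a') b) = inv (P.cupProduct a b) + inv (P.cupProduct a' b)
        have key : P.cupProduct (a + a') = P.cupProduct a + P.cupProduct a' := map_add P.cupProduct a a'
        rw [key, LinearMap.add_apply]
        exact map_add inv _ _ }
  have hB : ∀ a b, B a b = inv (P.cupProduct a b) := fun _ _ => rfl
  have hBcl : ∀ a b : galoisCohomology ρF 1, P.cupProduct a b = P.cupClass (rep a) (rep b) :=
    fun a b => (congrArg₂ (fun x y => P.cupProduct x y) (hrep a) (hrep b)).symm.trans
      (P.cupProduct_oneCocycleClass (rep a) (rep b))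
  clear_value B
  have hiso : ∀ a ∈ DiscreteGaloisModule.unramifiedSubgroup ρF 1,
      ∀ b ∈ DiscreteGaloisModule.unramifiedSubgroup ρF 1, B a b = 0 := by
    intro a ha b hb
    haveI : Finite (MuCarrier K n) := finite_muCarrier n K
    haveI : Subsingleton (continuousCohomology 2
        ((GaloisRep.restrictField F (mu K n)).quotientInvariants (galUnr F)).toTopRep) :=
      subsingleton_two_quotient_galUnr_of_finite F _ _
    have h0 : P.cupClass (rep a) (rep b) = 0 :=
      GaloisImage.UnramifiedCup.cupClass_eq_zero_of_vanishing_of_subsingleton (galUnr F)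
        ρF ρF (GaloisRep.restrictField F (mu K n)) P (rep a) (rep b)
        (fun t ht => (hU_iff a).mp ha t (by rw [← galUnr_eq_absInertia F]; exact ht))
        (fun t ht => (hU_iff b).mp hb t (by rw [← galUnr_eq_absInertia F]; exact ht))
    rw [hB, hBcl]
    exact (congrArg inv h0).trans (map_zero inv)
  have hflip_inj : Function.Injective B.flip := by
    intro b b' h
    have key : ∀ a : galoisCohomology ρF 1, B a b = B a b' := fun a => by
      have h' := DFunLike.congr_fun h a
      simpa only [AddMonoidHom.flip_apply] using h'
    rw [← sub_eq_zero]
    apply eq_zero_of_forall_weilCupProduct_eq_zero_right W n e hμ hadd₁ hadd₂ F hgal hnondeg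
    intro a
    have h1 : B a (b - b') = 0 := by rw [map_sub, key a, sub_self]
    exact hinv ((hB a (b - b')).symm.trans (h1.trans (map_zero inv).symm))
  have hleft_inj : ∀ a : galoisCohomology ρF 1, (∀ b, B a b = 0) → a = 0 := by
    intro a ha
    apply eq_zero_of_forall_weilCupProduct_eq_zero W n e hμ hadd₁ hadd₂ F hgal hnondeg
    intro b
    exact hinv ((hB a b).symm.trans ((ha b).trans (map_zero inv).symm))
  have hkerU : (ev s₁).ker = DiscreteGaloisModule.unramifiedSubgroup ρF 1 := by
    ext a; rw [AddMonoidHom.mem_ker]; exact hker a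
  have hcardV : Nat.card (galoisCohomology ρF 1) ≤
      Nat.card (DiscreteGaloisModule.unramifiedSubgroup ρF 1) *
        Nat.card (DiscreteGaloisModule.unramifiedSubgroup ρF 1) := by
    have h2 : Nat.card (galoisCohomology ρF 1 ⧸ (ev s₁).ker) ≤ Nat.card (geomTorsion W (n : ℤ)) :=
      Nat.card_le_card_of_injective _ (QuotientAddGroup.kerLift_injective (ev s₁))
    calc Nat.card (galoisCohomology ρF 1)
        = Nat.card (galoisCohomology ρF 1 ⧸ (ev s₁).ker) * Nat.card (ev s₁).ker :=
          AddSubgroup.card_eq_card_quotient_mul_card_addSubgroup _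
      _ ≤ Nat.card (geomTorsion W (n : ℤ)) * Nat.card (ev s₁).ker := Nat.mul_le_mul_right _ h2
      _ = _ := by rw [hkerU, hcardU]
  have hVn : ∀ y : galoisCohomology ρF 1, n • y = 0 :=
    nsmul_continuousCohomology_one_eq_zero _ n (fun x => AddSubgroup.torsionBy.nsmul x)
  have hann : ∀ y : galoisCohomology ρF 1,
      (∀ a ∈ DiscreteGaloisModule.unramifiedSubgroup ρF 1, B a y = 0) →
        y ∈ DiscreteGaloisModule.unramifiedSubgroup ρF 1 := by
    intro y hy; refine (forall_mem_apply_eq_zero_iff_of_isotropic_of_card_le B.flip hVn hflip_inj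
      (DiscreteGaloisModule.unramifiedSubgroup ρF 1) (DiscreteGaloisModule.unramifiedSubgroup ρF 1)
      (fun a ha b hb => by rw [AddMonoidHom.flip_apply]; exact hiso b hb a ha) hcardV y).mp ?_
    exact fun a ha => by rw [AddMonoidHom.flip_apply]; exact hy a ha
  have hsurj : Function.Surjective (ev s₁) := by
    have hUq : ∀ y : galoisCohomology ρF 1 ⧸ DiscreteGaloisModule.unramifiedSubgroup ρF 1, n • y = 0 := by
      intro y
      induction y using QuotientAddGroup.induction_on with
      | H z => rw [← QuotientAddGroup.mk_nsmul, hVn, QuotientAddGroup.mk_zero]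
    let Φ : DiscreteGaloisModule.unramifiedSubgroup ρF 1 →
        (galoisCohomology ρF 1 ⧸ DiscreteGaloisModule.unramifiedSubgroup ρF 1 →+ ZMod n) := fun u =>
      QuotientAddGroup.lift (DiscreteGaloisModule.unramifiedSubgroup ρF 1) (B u.1)
        fun y hy => (AddMonoidHom.mem_ker).mpr (hiso u.1 u.2 y hy)
    have hΦ : Function.Injective Φ := by
      intro u u' h
      apply Subtype.ext
      rw [← sub_eq_zero]
      apply hleft_inj
      intro y
      have h' := DFunLike.congr_fun h (y : galoisCohomology ρF 1 ⧸ DiscreteGaloisModule.unramifiedSubgroup ρF 1)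
      change QuotientAddGroup.lift _ (B u.1) _ (QuotientAddGroup.mk y) =
        QuotientAddGroup.lift _ (B u'.1) _ (QuotientAddGroup.mk y) at h'
      rw [QuotientAddGroup.lift_mk, QuotientAddGroup.lift_mk] at h'
      rw [map_sub, AddMonoidHom.sub_apply, h', sub_self]
    haveI : Finite (galoisCohomology ρF 1 ⧸ DiscreteGaloisModule.unramifiedSubgroup ρF 1 →+ ZMod n) :=
      finite_addMonoidHom_zmod _ n
    have hc1 : Nat.card (DiscreteGaloisModule.unramifiedSubgroup ρF 1) ≤
        Nat.card (galoisCohomology ρF 1 ⧸ DiscreteGaloisModule.unramifiedSubgroup ρF 1) :=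
      (Nat.card_le_card_of_injective Φ hΦ).trans_eq (Nat.card_addMonoidHom_zmod hUq)
    have hc2 : Nat.card (galoisCohomology ρF 1 ⧸ DiscreteGaloisModule.unramifiedSubgroup ρF 1) =
        Nat.card (ev s₁).range := by
      rw [← hkerU]
      exact Nat.card_congr (QuotientAddGroup.quotientKerEquivRange (ev s₁)).toEquiv
    have hc3 : Nat.card (ev s₁).range = Nat.card (geomTorsion W (n : ℤ)) :=
      le_antisymm (AddSubgroup.card_le_card_addGroup _) (by rw [← hcardU, ← hc2]; exact hc1)
    exact AddMonoidHom.range_eq_top.mp (AddSubgroup.eq_top_of_card_eq _ hc3)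
  have hSL : ∀ gM : geomTorsion W (n : ℤ) →+ geomTorsion W (n : ℤ), (∀ x y, Wp (gM x) (gM y) = Wp x y) →
      ∃ gV : galoisCohomology ρF 1 →+ galoisCohomology ρF 1,
        (∀ (a : galoisCohomology ρF 1) (t : absoluteGaloisGroup F), (rep (gV a)).1 t = gM ((rep a).1 t)) ∧
        (∀ a b : galoisCohomology ρF 1, B (gV a) (gV b) = B a b) := by
    intro gM hgM
    let α : ρF.toTopRep ⟶ ρF.toTopRep :=
      TopRep.ofHom ⟨⟨gM.toIntLinearMap, continuous_of_discreteTopology⟩, fun σ =>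
        ContinuousLinearMap.ext fun x => by
          change gM (ρF.toTopRep.ρ σ x) = ρF.toTopRep.ρ σ (gM x)
          rw [htrivX, htrivX]⟩
    have hα : ∀ x, α.hom x = gM x := fun _ => rfl
    let gV : galoisCohomology ρF 1 →+ galoisCohomology ρF 1 :=
      { toFun := fun a => cohomologyMap α 1 a
        map_zero' := map_zero _
        map_add' := fun a a' => map_add _ a a' }
    have hgV : ∀ a, gV a = cohomologyMap α 1 a := fun _ => rfl
    refine ⟨gV, fun a t => ?_, fun a b => ?_⟩
    · -- values
      have h1 : cohomologyMap α 1 (oneCocycleClass _ (rep a)) =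
          oneCocycleClass _ (contOneCocycles.pullback (ContinuousMonoidHom.id _) (resIdHom α) (rep a)) :=
        cohomologyMap_oneCocycleClass α (rep a)
      have h2 : gV a = cohomologyMap α 1 (oneCocycleClass _ (rep a)) :=
        congrArg (fun x => cohomologyMap α 1 x) (hrep a).symm
      have h3 : oneCocycleClass ρF.toTopRep (rep (gV a)) =
          oneCocycleClass _ (contOneCocycles.pullback (ContinuousMonoidHom.id _) (resIdHom α) (rep a)) :=
        (hrep _).trans (h2.trans h1)
      rw [apply_eq_of_oneCocycleClass_eq htrivX h3 t, pullback_id_resIdHom_apply, hα]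
    · -- the cup product is natural: `(gV a) ∪ (gV b) = H²(𝟙)(a ∪ b) = a ∪ b`
      have hmap := ContPairing.cupProduct_map P P α α (𝟙 _)
        (fun x y => (hgM x y).symm) a b
      have hid : cohomologyMap (𝟙 _) 2 (P.cupProduct a b) = P.cupProduct a b := by
        rw [hBcl, ← P.cupProduct_oneCocycleClass (rep a) (rep b),
          P.cupProduct_oneCocycleClass_eq_twoCocycleClass, cohomologyMap_twoCocycleClass]
        congr 1
      calc B (gV a) (gV b) = inv (P.cupProduct (gV a) (gV b)) := hB _ _
        _ = inv (cohomologyMap (𝟙 _) 2 (P.cupProduct a b)) := congrArg inv hmap.symm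
        _ = inv (P.cupProduct a b) := congrArg inv hid
        _ = B a b := (hB a b).symm
  let evUe : DiscreteGaloisModule.unramifiedSubgroup ρF 1 ≃ geomTorsion W (n : ℤ) :=
    Equiv.ofBijective evU hevU_bij
  have hevUe : ∀ x, ev frob (evUe.symm x).1 = x := fun x => by
    have h := evUe.apply_symm_apply x
    exact h
  have hφx_add : ∀ x x', (evUe.symm (x + x')).1 = (evUe.symm x).1 + (evUe.symm x').1 := fun x x' => by
    have hmem : (evUe.symm x).1 + (evUe.symm x').1 ∈ DiscreteGaloisModule.unramifiedSubgroup ρF 1 :=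
      add_mem (evUe.symm x).2 (evUe.symm x').2
    have h : evU (evUe.symm (x + x')) = evU ⟨_, hmem⟩ := by
      change ev frob (evUe.symm (x + x')).1 = ev frob ((evUe.symm x).1 + (evUe.symm x').1)
      rw [hevUe, map_add, hevUe, hevUe]
    exact congrArg Subtype.val (hevU_inj h)
  let sec : geomTorsion W (n : ℤ) → galoisCohomology ρF 1 := surjInv hsurj
  have hsec : ∀ y, ev s₁ (sec y) = y := fun y => surjInv_eq hsurj y
  have hBU : ∀ u ∈ DiscreteGaloisModule.unramifiedSubgroup ρF 1, ∀ b b' : galoisCohomology ρF 1,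
      ev s₁ b = ev s₁ b' → B u b = B u b' := by
    intro u hu b b' hbb'
    have hdiff : b - b' ∈ DiscreteGaloisModule.unramifiedSubgroup ρF 1 := by
      rw [← hker, map_sub, hbb', sub_self]
    rw [← sub_eq_zero, ← AddMonoidHom.map_sub]
    exact hiso u hu _ hdiff
  let Θ : geomTorsion W (n : ℤ) →+ geomTorsion W (n : ℤ) →+ ZMod n :=
    AddMonoidHom.mk' (fun x => AddMonoidHom.mk' (fun y => B (evUe.symm x).1 (sec y))
      (fun y y' => by
        change B (evUe.symm x).1 (sec (y + y')) = B (evUe.symm x).1 (sec y) + B (evUe.symm x).1 (sec y')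
        rw [← map_add]
        exact hBU _ (evUe.symm x).2 _ _ (by rw [hsec, map_add, hsec, hsec])))
      (fun x x' => by
        ext y
        change B (evUe.symm (x + x')).1 (sec y) = B (evUe.symm x).1 (sec y) + B (evUe.symm x').1 (sec y)
        rw [hφx_add, map_add, AddMonoidHom.add_apply])
  have hΘ : ∀ x y, Θ x y = B (evUe.symm x).1 (sec y) := fun _ _ => rfl
  clear_value Θ
  have hΘnd : ∀ x, (∀ y, Θ x y = 0) → x = 0 := by
    intro x hx
    have hu : (evUe.symm x).1 = 0 := by
      apply hleft_inj
      intro b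
      rw [hBU _ (evUe.symm x).2 b (sec (ev s₁ b)) (by rw [hsec]), ← hΘ]
      exact hx _
    rw [← hevUe x, hu, map_zero]
  have hΘinv : ∀ gM : geomTorsion W (n : ℤ) →+ geomTorsion W (n : ℤ),
      (∀ x y, Wp (gM x) (gM y) = Wp x y) → ∀ x y, Θ (gM x) (gM y) = Θ x y := by
    intro gM hgM x y
    obtain ⟨gV, hgVev, hgVB⟩ := hSL gM hgM
    have hgVU : ∀ a ∈ DiscreteGaloisModule.unramifiedSubgroup ρF 1,
        gV a ∈ DiscreteGaloisModule.unramifiedSubgroup ρF 1 := fun a ha => by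
      rw [hU_iff]
      intro t ht
      rw [hgVev, (hU_iff a).mp ha t ht, map_zero]
    have h1 : (evUe.symm (gM x)).1 = gV (evUe.symm x).1 := by
      have h : evU (evUe.symm (gM x)) = evU ⟨gV (evUe.symm x).1, hgVU _ (evUe.symm x).2⟩ := by
        change ev frob (evUe.symm (gM x)).1 = ev frob (gV (evUe.symm x).1)
        rw [hevUe, hev, hgVev, ← hev, hevUe]
      exact congrArg Subtype.val (hevU_inj h)
    have h2 : ev s₁ (sec (gM y)) = ev s₁ (gV (sec y)) := by
      rw [hsec, hev, hgVev, ← hev, hsec]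
    rw [hΘ, hΘ, h1, hBU _ (hgVU _ (evUe.symm x).2) _ _ h2, hgVB]
  have ha₀U : (oneCocycleClass ρF.toTopRep φ : galoisCohomology ρF 1) ∈
      DiscreteGaloisModule.unramifiedSubgroup ρF 1 :=
    (hU_iff _).mpr fun t ht => by rw [hrep_class]; exact hφ t ht
  have hx₀ : (evUe.symm (φ.1 frob)).1 = oneCocycleClass ρF.toTopRep φ := by
    have h : evU (evUe.symm (φ.1 frob)) = evU ⟨_, ha₀U⟩ := by
      change ev frob (evUe.symm (φ.1 frob)).1 = ev frob (oneCocycleClass ρF.toTopRep φ)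
      rw [hevUe, hev, hrep_class]
    exact congrArg Subtype.val (hevU_inj h)
  have hΘ0 : Θ (φ.1 frob) (ψ.1 s₁) = 0 := by
    rw [hΘ, hx₀, hBU _ ha₀U (sec (ψ.1 s₁)) (oneCocycleClass ρF.toTopRep ψ)
      (by rw [hsec, hev, hrep_class]), hB]
    exact (congrArg inv hcup).trans (map_zero inv)
  have hW0 : Wp (φ.1 frob) (ψ.1 s₁) = 0 :=
    (eq_zero_iff_of_isometry_invariant ε Wp hWalt hWnd Θ hΘinv hΘnd (φ.1 frob) (ψ.1 s₁)).mp hΘ0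
  obtain ⟨k, hk⟩ : ∃ k : ℕ, ψ.1 t = k • ψ.1 s₁ := by
    obtain ⟨k, hk⟩ := htame (oneCocycleClass ρF.toTopRep ψ) t ht
    rw [hrep_class, hrep_class] at hk
    exact ⟨k, hk⟩
  obtain ⟨k', hk'⟩ := exists_apply_eq_zsmul_apply_frob F ρF htriv φ hφ hfrob g
  rw [← weilPairingHom_eq_zero_iff W n e hμ hadd₁ hadd₂, ← hWp, hk, hk', map_zsmul, map_nsmul,
    AddMonoidHom.zsmul_apply, hW0, smul_zero, smul_zero]

end Main

end Summit.BirchSwinnertonDyer.Rank1Residual.X11b.TameCup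

end
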